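import Literature.NumberTheory.LFunctions.VinogradovKorobovZeroDetector
import HarnessLib

/-!
# Kadiri's fundamental inequality: positivity of the twisted mollified sum `Σ_k a_k [Re K_f(σ+ikt) − κ Re K_f(σ+δ+ikt)] ≥ 0` (Acta Arith. 117 (2005), (1.3), §3.1)

Topic `Literature/NumberTheory/LFunctions`. Everything in this file is PROVED (no named fact, no
definition). The starting point of Kadiri's method (and of Mossinghoff–Trudgian 2015 §2,
Mossinghoff–Trudgian–Yang 2024 §9) is the positivity, for a non-negative trigonometric polynomial
`P(φ) = Σ_{k=0}^n a_k cos(kφ) ≥ 0`, a non-negative compactly supported test function `f`, real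
`σ`, `t`, and `0 ≤ κ ≤ 1`, `δ ≥ 0`, of

  `Σ_{k=0}^n a_k [Re K_f(σ + ikt) − κ Re K_f(σ + δ + ikt)]
     = Σ_n Λ(n) f(log n) n^{−σ} (1 − κ n^{−δ}) P(t log n) ≥ 0`,

`K_f(s) = Σ Λ(n) f(log n) n^{−s}` (`fordK`). The tree had the case `σ = 1`, `κ = 0`
(`fordK_trigPoly_nonneg`, Ford (6.1)); here the general abscissa and the twist by `1 − κ n^{−δ}`.

## References

* H. Kadiri, *Une région explicite sans zéros pour la fonction ζ de Riemann*, Acta Arith. 117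
  (2005) = arXiv:math/0401238, (1.3) and §3.1. (`Kadiri2005`)
* M. J. Mossinghoff, T. S. Trudgian, J. Number Theory 157 (2015) = arXiv:1410.3926, §2.
  (`MossinghoffTrudgian2015`)
-/

noncomputable section

open Complex Real Finset

namespace Literature.NumberTheory.LFunctions

namespace KadiriFundamental

/-- `Re K_f(σ + iτ)` as a finite sum: `Σ_n Λ(n) f(log n) n^{−σ} cos(τ log n)` when `f` vanishes on
`[x₀, ∞)`. [cite: Kadiri2005, §3.1] -/
theorem re_fordK_apply {f : ℝ → ℝ} {x₀ : ℝ} (hf : ∀ u, x₀ ≤ u → f u = 0) (σ τ : ℝ) :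
    (fordK f ((σ : ℂ) + τ * I)).re =
      ∑ n ∈ range ⌈Real.exp x₀⌉₊,
        ArithmeticFunction.vonMangoldt n * f (Real.log n) * ((n : ℝ) ^ (-σ) * Real.cos (τ * Real.log n)) := by
  have hN : 1 ≤ ⌈Real.exp x₀⌉₊ := Nat.one_le_iff_ne_zero.2 (Nat.ceil_pos.2 (Real.exp_pos _)).ne'
  have hx : x₀ ≤ Real.log (⌈Real.exp x₀⌉₊ : ℕ) := by
    have h1 : Real.exp x₀ ≤ (⌈Real.exp x₀⌉₊ : ℕ) := Nat.le_ceil _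
    calc x₀ = Real.log (Real.exp x₀) := (Real.log_exp x₀).symm
      _ ≤ _ := Real.log_le_log (Real.exp_pos _) h1
  rw [fordK_eq_sum hf hN hx, Complex.re_sum]
  refine sum_congr rfl fun n _ ↦ ?_
  rcases Nat.eq_zero_or_pos n with rfl | hn
  · simp
  have hnC : (n : ℂ) ≠ 0 := by exact_mod_cast hn.ne'
  have hnR : (0 : ℝ) < n := by exact_mod_cast hn
  rw [Complex.cpow_def_of_ne_zero hnC, ← Complex.natCast_log,
    show ((ArithmeticFunction.vonMangoldt n : ℝ) : ℂ) * (f (Real.log n) : ℂ)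
      = ((ArithmeticFunction.vonMangoldt n * f (Real.log n) : ℝ) : ℂ) by push_cast; ring,
    Complex.re_ofReal_mul, Complex.exp_re]
  congr 1
  have hre : ((Real.log n : ℂ) * -((σ : ℂ) + τ * I)).re = -(σ * Real.log n) := by
    simp only [Complex.mul_re, Complex.neg_re, Complex.neg_im, Complex.add_re, Complex.add_im,
      Complex.ofReal_re, Complex.ofReal_im, Complex.mul_im, Complex.mul_re, Complex.I_re, Complex.I_im]
    ring
  have him : ((Real.log n : ℂ) * -((σ : ℂ) + τ * I)).im = -(τ * Real.log n) := by
    simp only [Complex.mul_re, Complex.neg_re, Complex.neg_im, Complex.add_re, Complex.add_im,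
      Complex.ofReal_re, Complex.ofReal_im, Complex.mul_im, Complex.mul_re, Complex.I_re, Complex.I_im]
    ring
  rw [hre, him, Real.cos_neg, Real.rpow_def_of_pos hnR]
  congr 1
  ring_nf

/-- `n^{−(σ+δ)} ≤ n^{−σ}` for `n ≥ 1`, `δ ≥ 0`. [folklore] -/
theorem rpow_neg_add_le {n : ℕ} (hn : 1 ≤ n) {σ δ : ℝ} (hδ : 0 ≤ δ) :
    (n : ℝ) ^ (-(σ + δ)) ≤ (n : ℝ) ^ (-σ) :=
  Real.rpow_le_rpow_of_exponent_le (by exact_mod_cast hn) (by linarith)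

/-- **Kadiri's fundamental inequality** ((1.3) with the weight `1 − κ n^{−δ} ≥ 0`): for `f ≥ 0`
vanishing on `[x₀, ∞)`, a non-negative trigonometric polynomial `Σ_{k ≤ K} b_k cos(kx) ≥ 0` with
`b_k ≥ 0`, `κ ≤ 1`, `δ ≥ 0` and real `σ, t` (no sign condition on `κ` is needed:
`n^{−σ} − κn^{−σ−δ} = (1−κ)n^{−σ−δ} + (n^{−σ} − n^{−σ−δ})`),
`0 ≤ Σ_{k=0}^{K} b_k [Re K_f(σ + ikt) − κ Re K_f(σ + δ + ikt)]`. [cite: Kadiri2005, (1.3)] -/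
theorem twisted_trigPoly_nonneg {f : ℝ → ℝ} {x₀ : ℝ} (hf0 : ∀ u, 0 ≤ f u)
    (hf : ∀ u, x₀ ≤ u → f u = 0) {K : ℕ} {b : ℕ → ℝ} (hb : IsNonnegTrigPoly K b)
    {κ δ : ℝ} (hκ1 : κ ≤ 1) (hδ : 0 ≤ δ) (σ t : ℝ) :
    0 ≤ ∑ j ∈ range (K + 1), b j *
      ((fordK f ((σ : ℂ) + ((j : ℝ) * t : ℝ) * I)).re -
        κ * (fordK f (((σ + δ : ℝ) : ℂ) + ((j : ℝ) * t : ℝ) * I)).re) := by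
  simp_rw [re_fordK_apply hf, mul_sum, ← sum_sub_distrib, mul_sum]
  rw [sum_comm]
  refine sum_nonneg fun n _ ↦ ?_
  have e : ∑ j ∈ range (K + 1), b j *
      (ArithmeticFunction.vonMangoldt n * f (Real.log n) * ((n : ℝ) ^ (-σ) * Real.cos ((j : ℝ) * t * Real.log n))
        - κ * (ArithmeticFunction.vonMangoldt n * f (Real.log n) *
            ((n : ℝ) ^ (-(σ + δ)) * Real.cos ((j : ℝ) * t * Real.log n))))
      = ArithmeticFunction.vonMangoldt n * f (Real.log n) * ((n : ℝ) ^ (-σ) - κ * (n : ℝ) ^ (-(σ + δ)))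
          * trigPoly K b (t * Real.log n) := by
    rw [trigPoly, mul_sum]
    refine sum_congr rfl fun j _ ↦ ?_
    rw [show (j : ℝ) * t * Real.log n = j * (t * Real.log n) by ring]
    ring
  rw [e]
  rcases Nat.eq_zero_or_pos n with rfl | hn
  · simp
  refine mul_nonneg (mul_nonneg (mul_nonneg ArithmeticFunction.vonMangoldt_nonneg (hf0 _)) ?_) (hb.2.2 _)
  have h1 := rpow_neg_add_le hn (σ := σ) hδ
  have h2 : 0 ≤ (n : ℝ) ^ (-(σ + δ)) := Real.rpow_nonneg n.cast_nonneg _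
  nlinarith

/-- The same with the `k = 0` term separated (`Re K_f(σ)` real point):
`0 ≤ b₀ [Re K_f(σ) − κ Re K_f(σ+δ)] + Σ_{k=1}^{K} b_k [Re K_f(σ+ikt) − κ Re K_f(σ+δ+ikt)]`.
[cite: Kadiri2005, (1.3)] -/
theorem twisted_trigPoly_nonneg' {f : ℝ → ℝ} {x₀ : ℝ} (hf0 : ∀ u, 0 ≤ f u)
    (hf : ∀ u, x₀ ≤ u → f u = 0) {K : ℕ} {b : ℕ → ℝ} (hb : IsNonnegTrigPoly K b)
    {κ δ : ℝ} (hκ1 : κ ≤ 1) (hδ : 0 ≤ δ) (σ t : ℝ) :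
    0 ≤ b 0 * ((fordK f (σ : ℂ)).re - κ * (fordK f ((σ + δ : ℝ) : ℂ)).re) +
      ∑ j ∈ range K, b (j + 1) *
        ((fordK f ((σ : ℂ) + ((((j : ℝ) + 1) * t : ℝ) : ℂ) * I)).re -
          κ * (fordK f (((σ + δ : ℝ) : ℂ) + ((((j : ℝ) + 1) * t : ℝ) : ℂ) * I)).re) := by
  have h := twisted_trigPoly_nonneg hf0 hf hb hκ1 hδ σ t
  rw [sum_range_succ'] at h
  have e0 : ((((0 : ℕ) : ℝ) * t : ℝ) : ℂ) * I = 0 := by simp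
  have e1 : ∀ j : ℕ, ((((j + 1 : ℕ) : ℝ) * t : ℝ) : ℂ) = ((((j : ℝ) + 1) * t : ℝ) : ℂ) := by
    intro j; push_cast; ring
  simp only [e0, add_zero] at h
  simp_rw [e1] at h
  linarith

end KadiriFundamental

end Literature.NumberTheory.LFunctions
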